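import Literature.IUT.HodgeArakelov.TemperedCurveXu
import Literature.AnabelianGeometry.EtaleTheta.DoubleUnderlineTower
import HarnessLib

/-!
# The tempered curve `X̲̲_v` ([IUTchI] Def 3.1 (e)/(f); [EtTh] §2 `X̲̲ → X̲ → X`) as an instance of `TemperedCurve.ofOpenSubgroup`

S. Mochizuki, *Inter-universal Teichmüller Theory I*, kurims manuscript (May 2020), Def. 3.1 (e)–(f) p. 62 ([IUTchII] §2: `Π_v :=
Π^tp_{X̲̲_v}`) [claim: Mochizuki2012, status: disputed] (D-0012 claim key; nothing of the series is asserted — a classical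
covering-theory CONSTRUCTION over abc-iut-L2's [EtTh] data); *The étale theta function …* [EtTh] Prop. 2.2 (iii) p. 37, Rmk. 2.3.1
(`Π^tp_X̲̲ ≤ Π^tp_X` open of index `l²`, onto `G_K`) [cite: MochizukiEtTh2009, Prop 2.2 (iii) p.37].

MERGE BRIDGE (plan/L6/MERGE-MAP.md — sibling of `TemperedCurveXu.lean` (p434191) for the level `Π_v = Π^tp_{X̲̲_v}`; writer
abc-iut-L6-t7 gen 3; named consumer: the «PROP22i-IDENT-GENUINE» row of abc-iut-L6-lead §F v1.19ah — the identification binders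
of the [IUTchII] Prop 2.2 (i)′ closers live at `Π_v` with abc-iut-L5's `StableCurveTemperedData` of `X̲̲_v`): the tempered-curve datum OF
THE COVERING `X̲̲_v → X_v` (`Π^tp := Π^tp_X̲̲ = C.Huu` for `C : DoubleUnderline l` — abc-iut-L2-t8's `isOpen_Huu`, `index_Huu = l²`,
`map_aug_Huu = G_K`), with base field `K`, hypothesis-free over `GroupLevelData` exactly as for `X̲_v`.  DEF-BEARING (post-freeze def,
reading (ii)).  Nothing here takes a side on [IUTchIII] Cor. 3.12; constructed ≠ the paper's reconstruction algorithms.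
-/

noncomputable section

namespace Literature.AnabelianGeometry.EtaleTheta

open Literature.AnabelianGeometry.SemiGraphs

namespace ThetaSetting

namespace EtaleThetaData.DoubleUnderline

variable {p : ℕ} [Fact p.Prime] {D : ThetaSetting p} {E : D.EtaleThetaData} {l : ℕ} (C : E.DoubleUnderline l)

/-- `aug(Π^tp_X̲̲) = G_K` in the shape `TemperedCurve.ofOpenSubgroup` asks (abc-iut-L2-t8's `map_aug_Huu`, [EtTh] Prop. 2.2 (iii)).
[cite: MochizukiEtTh2009, Prop 2.2 (iii) p.37] -/
theorem range_aug_comp_Huu_subtype :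
    (D.aug.toMonoidHom.comp C.Huu.subtype).range = D.K.fixingSubgroup := by
  rw [MonoidHom.range_comp, Subgroup.range_subtype]
  exact C.map_aug_Huu

/-- **The tempered curve `X̲̲_v`**: abc-iut-L3's `TemperedCurve.ofOpenSubgroup` (p432410) at the open index-`l²` subgroup
`Π^tp_X̲̲ = C.Huu ≤ Π^tp_X` with base field `K`, granted the printed openness `hDopen` of the images in `G_K` of its decomposition
groups. ([IUTchI] Def 3.1 (e), kurims p.62) [claim: Mochizuki2012, status: disputed] -/
def temperedCurveXuu (hl : l ≠ 0)
    (hDopen : ∀ (x : D.Pt) (g : D.PiTemp),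
      IsOpen (D.aug '' ((D.toTemperedCurve.decompOfOpenAt C.Huu x g).map C.Huu.subtype : Set D.PiTemp))) :
    TemperedCurve p :=
  haveI : C.Huu.FiniteIndex := ⟨by rw [C.index_Huu]; exact pow_ne_zero 2 hl⟩
  haveI : FiniteDimensional ℚ_[p] D.K := D.finiteDimensional_K
  D.toTemperedCurve.ofOpenSubgroup C.Huu C.isOpen_Huu D.K C.range_aug_comp_Huu_subtype hDopen

/-- **The tempered curve `X̲̲_v`, hypothesis-free form over `GroupLevelData`** (openness of `D_y ↠ G_K` from the compactness of the
`D_x`, `decompCompact_of_groupLevelData` + `hDopen_of_isCompact_decomp`). ([IUTchI] Def 3.1 (e), kurims p.62) [claim: Mochizuki2012, status: disputed] -/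
def temperedCurveXuuOfLevelData (hl : l ≠ 0) (d : D.toTemperedCurve.GroupLevelData) : TemperedCurve p :=
  C.temperedCurveXuu hl (D.toTemperedCurve.hDopen_of_isCompact_decomp C.Huu C.isOpen_Huu
    (D.toTemperedCurve.decompCompact_of_groupLevelData d))

/-- `Π^tp_{X̲̲_v} = C.Huu` (`rfl`). ([IUTchI] Def 3.1 (e), kurims p.62) [claim: Mochizuki2012, status: disputed] -/
theorem temperedCurveXuuOfLevelData_PiTemp (hl : l ≠ 0) (d : D.toTemperedCurve.GroupLevelData) :
    (C.temperedCurveXuuOfLevelData hl d).PiTemp = ↥C.Huu := rfl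

/-- `Π̂_{X̲̲_v}` is the closure of `Π^tp_X̲̲` in `Π_X` (`rfl`). ([IUTchI] Def 3.1 (e), kurims p.62) [claim: Mochizuki2012, status: disputed] -/
theorem temperedCurveXuuOfLevelData_PiHat (hl : l ≠ 0) (d : D.toTemperedCurve.GroupLevelData) :
    (C.temperedCurveXuuOfLevelData hl d).PiHat = ↥(D.toTemperedCurve.hatOfOpen C.Huu) := rfl

/-- The base field of `X̲̲_v` is `K` (`rfl`). ([IUTchI] Def 3.1 (e), kurims p.62) [claim: Mochizuki2012, status: disputed] -/
theorem temperedCurveXuuOfLevelData_K (hl : l ≠ 0) (d : D.toTemperedCurve.GroupLevelData) :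
    (C.temperedCurveXuuOfLevelData hl d).K = D.K := rfl

/-- The augmentation of `X̲̲_v` is the restriction of that of `X` (`rfl`). ([IUTchI] Def 3.1 (e), kurims p.62) [claim: Mochizuki2012, status: disputed] -/
theorem temperedCurveXuuOfLevelData_aug_apply (hl : l ≠ 0) (d : D.toTemperedCurve.GroupLevelData) (h : C.Huu) :
    (C.temperedCurveXuuOfLevelData hl d).aug h = D.aug h := rfl

/-- `Π^tp_{X̲̲_v} → Π̂_{X̲̲_v}` IS a profinite completion. ([IUTchI] Def 3.1 (e), kurims p.62) [claim: Mochizuki2012, status: disputed] -/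
theorem isProfiniteCompletion_temperedCurveXuuOfLevelData_toHat (hl : l ≠ 0) (d : D.toTemperedCurve.GroupLevelData) :
    IsProfiniteCompletion (C.temperedCurveXuuOfLevelData hl d).toHat :=
  (C.temperedCurveXuuOfLevelData hl d).isProfiniteCompletion_toHat

/-- **The parameter bundle of `X̲̲_v` from that of `X_v`** (piece 1d `GroupLevelData.ofOpenSubgroup`): abc-iut-L5's `ofSpecialFibre`
at `X̲̲_v` needs only the special-fibre data. ([IUTchI] Def 3.1 (e), kurims p.62) [claim: Mochizuki2012, status: disputed] -/
def groupLevelDataXuu (hl : l ≠ 0) (d : D.toTemperedCurve.GroupLevelData) :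
    (C.temperedCurveXuuOfLevelData hl d).GroupLevelData :=
  haveI : C.Huu.FiniteIndex := ⟨by rw [C.index_Huu]; exact pow_ne_zero 2 hl⟩
  haveI : FiniteDimensional ℚ_[p] D.K := D.finiteDimensional_K
  TemperedCurve.GroupLevelData.ofOpenSubgroup D.toTemperedCurve C.Huu C.isOpen_Huu C.range_aug_comp_Huu_subtype
    (D.toTemperedCurve.hDopen_of_isCompact_decomp C.Huu C.isOpen_Huu
      (D.toTemperedCurve.decompCompact_of_groupLevelData d)) d

end EtaleThetaData.DoubleUnderline

end ThetaSetting

end Literature.AnabelianGeometry.EtaleTheta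

end
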